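import Literature.NumberTheory.EllipticCurves.ArtinFormalismQuadraticLocalProofs
import Literature.NumberTheory.EllipticCurves.BSDQuadraticDescentProofs
import Mathlib.NumberTheory.RamificationInertia.Galois
import HarnessLib

/-!
# Artin formalism for a relative quadratic extension `M/K` of number fields, place by place

`Proofs` file (theorems only) in topic `NumberTheory/EllipticCurves`: the relative version of
`Literature.NumberTheory.EllipticCurves.ArtinFormalismQuadraticLocalProofs` (there over the base
`ℚ`, here over an arbitrary number field `K`).  Let `E/K` be an elliptic curve, `M = K(θ)` a
quadratic extension with `θ² = D ∈ K`, `θ ∉ K`, `E^{(D)} = W.quadraticTwist D` the quadratic twist,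
`v` a finite place of `K` and `w ∣ v` a place of `M`.  For Mathlib's local polynomials
`L_w = (W.baseChange M).localPolynomialAt w`, `L_v = W.localPolynomialAt v`,
`L_v^{(D)} = (W.quadraticTwist D).localPolynomialAt v`
(`WeierstrassCurve.localPolynomialAt_baseChange_relQuadratic`):

* (split) `e(w|v) = f(w|v) = 1`: `L_w = L_v` and `L_v^{(D)} = L_v`;
* (inert) `e(w|v) = 1`, `f(w|v) = 2`: `expand 2 L_w = L_v · L_v^{(D)}` and
  `L_v^{(D)}(T) = L_v(-T)`;
* (ramified) `w` the only place above `v`, `f(w|v) = 1`: `L_w = L_v · L_v^{(D)}`.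

The proof is the Galois-theoretic one of the base-`ℚ` file, verbatim over `K`: all three local
polynomials are reversed characteristic polynomials of Frobenius on inertia coinvariants of the
`ℓ`-adic Tate module (`reverse_charpoly_toInertiaCoinvariants_eq_localPolynomialAt`),
`V_ℓ(E_M) ≅ V_ℓ(E)|_{Γ_M}` (`exists_rationalTateModule_equiv_baseChange`),
`V_ℓ(E^{(D)}) ≅ V_ℓ(E) ⊗ χ` for the quadratic character `χ` of `M/K`
(`exists_rationalTateModule_equiv_quadraticTwist`, `exists_quadraticCharacter`), `res(Γ_M)` is the
stabiliser of `√D` (`mem_range_absGaloisRestrict_of_smul_geomSqrt`), and the identities of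
characteristic polynomials on coinvariants are `charpoly_toCoinvariants_twist`,
`expand_two_reverse_charpoly_mul_self`, `charpoly_toCoinvariants_inf_ker_eq_mul`.  The place-by-place
trichotomy for `[M : K] = 2` (`placesOver_trichotomy_relQuadratic`) is Mathlib's fundamental
identity `g · e · f = 2` for the Galois extension `M/K`, and the local identities assemble into the
identity of Euler factors above `v`,
`∏_{w ∣ v} L_w(E_M, N w^{-s})⁻¹ = L_v(E, N v^{-s})⁻¹ · L_v(E^{(D)}, N v^{-s})⁻¹`
(`finprod_localEulerFactor_baseChange_relQuadratic`), exactly as in `BSDQuadraticDescentProofs`.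
Ireland–Rosen state the case `K = ℚ` (Prop. 20.5.4 (b)); the relative statement is the same
Artin formalism `L(E/M, s) = L(E/K, s) L(E/K ⊗ χ_{M/K}, s)` (Neukirch VII (10.4) (iv) for the
formalism; Silverman C.16 for the Euler factors).

## References

* K. Ireland, M. Rosen, *A Classical Introduction to Modern Number Theory*, 2nd ed. (1990),
  Ch. 20 §5, Prop. 20.5.4 (b). [IrelandRosen1990]
* J. Neukirch, *Algebraic Number Theory* (1999), Ch. VII (10.4). [NeukirchANT1999]
* J. H. Silverman, *The Arithmetic of Elliptic Curves*, 2nd ed. (2009), X.5 Cor. 5.4, §C.16.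
  [SilvermanAEC2009]
-/

noncomputable section

open scoped Classical NumberField Pointwise
open Field IsDedekindDomain NumberField Polynomial

universe u

namespace WeierstrassCurve

open Literature.NumberTheory.EllipticCurves Literature.NumberTheory.GaloisRepresentations
  Literature.NumberTheory.QuadraticFields Literature.RepresentationTheory.Semisimple
  ArithmeticFunction

/-! ## `det(1 + FT)` is `det(1 - FT)` at `-T` -/

/-- For an endomorphism `F` of a finite free module, the reversed characteristic polynomial of
`-F` is that of `F` composed with `-X`: `det(1 + FT) = det(1 - F(-T))` (Mathlib
`Matrix.reverse_charpoly`). [folklore] -/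
theorem _root_.Literature.NumberTheory.EllipticCurves.reverse_charpoly_neg {k V : Type*} [Field k]
    [AddCommGroup V] [Module k V] [FiniteDimensional k V] (F : Module.End k V) :
    (-F).charpoly.reverse = F.charpoly.reverse.comp (-X) := by
  classical
  set b := Module.Free.chooseBasis k V
  set M : Matrix _ _ k := LinearMap.toMatrix b b F with hM
  have hF : F.charpoly = M.charpoly := (LinearMap.charpoly_toMatrix F b).symm
  have hnF : (-F).charpoly = (-M).charpoly := by
    rw [← LinearMap.charpoly_toMatrix (-F) b, map_neg, ← hM]
  rw [hF, hnF]
  simp only [Matrix.reverse_charpoly, Matrix.charpolyRev]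
  have hcomp : ∀ p : k[X], p.comp (-X) = Polynomial.compRingHom (-X : k[X]) p := fun _ ↦ rfl
  rw [hcomp, RingHom.map_det]
  congr 1
  ext i j
  rw [RingHom.mapMatrix_apply, Matrix.map_apply, ← hcomp]
  simp only [Matrix.sub_apply, Matrix.smul_apply, Matrix.neg_apply, Matrix.map_apply,
    smul_eq_mul, sub_comp, mul_comp, X_comp, C_comp, map_neg]
  by_cases hij : i = j
  · subst hij
    simp
  · simp [Matrix.one_apply_ne hij]

variable {K₀ : Type u} [Field K₀] [NumberField K₀] (W : WeierstrassCurve K₀) [W.IsElliptic]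
  (M : Type u) [Field M] [NumberField M] [Algebra K₀ M]

set_option maxHeartbeats 1600000 in
/-- **Artin formalism for a relative quadratic base change, place by place.**  Let `E/K` be an
elliptic curve over a number field, `M/K` quadratic with `M = K(θ)`, `θ² = D ∈ K`, `θ ∉ K`,
`E^{(D)} = W.quadraticTwist D`, `w ∣ v` finite places of `M` and `K`, and write
`L_w = (W.baseChange M).localPolynomialAt w`, `L_v = W.localPolynomialAt v`,
`L_v^{(D)} = (W.quadraticTwist D).localPolynomialAt v`.  Then: (split) if `e(w|v) = f(w|v) = 1`,
`L_w = L_v` and `L_v^{(D)} = L_v`; (inert) if `e(w|v) = 1` and `f(w|v) = 2`,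
`expand 2 L_w = L_v · L_v^{(D)}` and `L_v^{(D)} = L_v ∘ (-T)`; (ramified) if `w` is the only place
of `M` above `v` and `f(w|v) = 1`, `L_w = L_v · L_v^{(D)}`.  (Ireland–Rosen Prop. 20.5.4 (b) over
`ℚ`; the same Galois-theoretic proof over `K`, see the module docstring.)
[cite: IrelandRosen1990, Ch. 20 §5, Prop. 20.5.4(b) (PDF p. 353)] -/
theorem localPolynomialAt_baseChange_relQuadratic (h2 : Module.finrank K₀ M = 2)
    {D : K₀} (hD0 : D ≠ 0) {θ : M} (hθ : θ ^ 2 = algebraMap K₀ M D)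
    (hθF : θ ∉ Set.range (algebraMap K₀ M))
    {v : HeightOneSpectrum (𝓞 K₀)} {w : HeightOneSpectrum (𝓞 M)}
    (hw : w.asIdeal.under (𝓞 K₀) = v.asIdeal) :
    (w.asIdeal.ramificationIdx (𝓞 K₀) = 1 → w.asIdeal.inertiaDeg (𝓞 K₀) = 1 →
      (W.baseChange M).localPolynomialAt w = W.localPolynomialAt v ∧
        (W.quadraticTwist D).localPolynomialAt v = W.localPolynomialAt v) ∧
    (w.asIdeal.ramificationIdx (𝓞 K₀) = 1 → w.asIdeal.inertiaDeg (𝓞 K₀) = 2 →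
      expand ℤ 2 ((W.baseChange M).localPolynomialAt w) =
        W.localPolynomialAt v * (W.quadraticTwist D).localPolynomialAt v ∧
      (W.quadraticTwist D).localPolynomialAt v = (W.localPolynomialAt v).comp (-X)) ∧
    ((∀ w' : HeightOneSpectrum (𝓞 M), w'.asIdeal.under (𝓞 K₀) = v.asIdeal → w' = w) →
      w.asIdeal.inertiaDeg (𝓞 K₀) = 1 →
      (W.baseChange M).localPolynomialAt w =
        W.localPolynomialAt v * (W.quadraticTwist D).localPolynomialAt v) := by
  /- ### Setup: a prime `ℓ ∤ v`, the fields, the character, the Tate modules -/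
  haveI hEd : (W.quadraticTwist D).IsElliptic := W.isElliptic_quadraticTwist hD0
  haveI hEK : (W.baseChange M).IsElliptic := by rw [baseChange]; infer_instance
  haveI : FiniteDimensional K₀ M := Module.finite_of_finrank_pos (by rw [h2]; exact two_pos)
  haveI : Algebra.IsQuadraticExtension K₀ M := ⟨h2⟩
  haveI : Algebra.IsAlgebraic K₀ M := Algebra.IsAlgebraic.of_finite K₀ M
  obtain ⟨ℓ, hℓp, hℓv⟩ := HeightOneSpectrum.exists_prime_natCast_not_mem v
  haveI : Fact ℓ.Prime := ⟨hℓp⟩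
  have hℓw : (ℓ : 𝓞 M) ∉ w.asIdeal := by
    intro hmem
    apply hℓv
    have : (ℓ : 𝓞 M) = algebraMap (𝓞 K₀) (𝓞 M) ℓ := by simp
    rw [this] at hmem
    rw [← hw, Ideal.under_def, Ideal.mem_comap]
    exact hmem
  -- the quadratic character `χ = χ_{M/K} : Γ_K → ℚ_ℓˣ` and `H = res(Γ_M) = ker χ`
  obtain ⟨χ, hχ1, hχ2, hχpm⟩ := exists_quadraticCharacter (F := K₀) hD0 ℚ_[ℓ]
  set H := (absGaloisRestrict K₀ M).range with hH
  have hHχ : ∀ γ : absoluteGaloisGroup M, χ (absGaloisRestrict K₀ M γ) = 1 := fun γ ↦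
    hχ1 _ (absGaloisRestrict_smul_geomSqrt hθ γ)
  have hm1 : (-1 : ℚ_[ℓ]ˣ) ≠ 1 := by
    intro h
    have h' : ((-1 : ℚ_[ℓ]ˣ) : ℚ_[ℓ]) = ((1 : ℚ_[ℓ]ˣ) : ℚ_[ℓ]) := by rw [h]
    rw [Units.val_neg, Units.val_one] at h'
    exact absurd h' (by norm_num)
  have hχH : ∀ σ : absoluteGaloisGroup K₀, χ σ = 1 → σ ∈ H := by
    intro σ hσ
    rcases smul_geomSqrt_eq_or σ D with h | h
    · exact mem_range_absGaloisRestrict_of_smul_geomSqrt h2 hθF hθ h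
    · exact absurd ((hχ2 σ h).symm.trans hσ) hm1
  have hχne : ∀ σ : absoluteGaloisGroup K₀, χ σ ≠ 1 → χ σ = -1 := fun σ h ↦
    (hχpm σ).resolve_left h
  -- the three `ℓ`-adic representations and the two comparison isomorphisms
  haveI := W.module_finite_rationalTateModule_holds ℓ
  haveI := (W.baseChange M).module_finite_rationalTateModule_holds ℓ
  haveI := (W.quadraticTwist D).module_finite_rationalTateModule_holds ℓ
  have hcW := W.continuous_rationalGaloisRepTate_holds ℓ
  have hcK := (W.baseChange M).continuous_rationalGaloisRepTate_holds ℓ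
  have hcd := (W.quadraticTwist D).continuous_rationalGaloisRepTate_holds ℓ
  set ρ := rationalTateGaloisRepOf (geomPoints W) ℓ hcW with hρ
  set ρK := rationalTateGaloisRepOf (geomPoints (W.baseChange M)) ℓ hcK with hρK
  set ρd := rationalTateGaloisRepOf (geomPoints (W.quadraticTwist D)) ℓ hcd with hρd
  obtain ⟨EK, hEK⟩ := W.exists_rationalTateModule_equiv_baseChange M ℓ
  obtain ⟨Ed, hEd⟩ := W.exists_rationalTateModule_equiv_quadraticTwist hD0 ℓ χ hχ1 hχ2
  /- ### The primes: `𝔔 ∣ w`, a Frobenius `Φ` of `M`, `𝔓 = ι⁻¹ 𝔔 ∣ v` -/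
  obtain ⟨𝔔, h𝔔⟩ := HeightOneSpectrum.primesAbove_nonempty w
  haveI : 𝔔.IsPrime := h𝔔.1
  obtain ⟨Φ, hΦ⟩ := HeightOneSpectrum.exists_isArithFrobAt_of_mem_primesAbove_holds h𝔔
  set 𝔓 := 𝔔.comap (absIntegersMap K₀ M) with h𝔓def
  have h𝔓 : 𝔓 ∈ v.primesAbove := comap_absIntegersMap_mem_primesAbove hw h𝔔
  haveI : 𝔓.IsPrime := h𝔓.1
  set DQ := 𝔔.decompositionSubgroup (absoluteGaloisGroup M) with hDQ
  set DP := 𝔓.decompositionSubgroup (absoluteGaloisGroup K₀) with hDP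
  have hΦD : Φ ∈ DQ := hΦ.mem_stabilizer
  have hresD : ∀ γ : absoluteGaloisGroup M, γ ∈ DQ → absGaloisRestrict K₀ M γ ∈ DP := by
    intro γ hγ
    have h : γ ∈ DP.comap (absGaloisRestrict K₀ M).toMonoidHom := by
      rw [hDP, h𝔓def, comap_decompositionSubgroup_comap_absIntegersMap K₀ M 𝔔]
      exact hγ
    exact h
  -- the restriction `D_𝔔 → D_𝔓`
  set f : DQ →* DP := ((absGaloisRestrict K₀ M).toMonoidHom.comp DQ.subtype).codRestrict DP
    (fun γ ↦ hresD γ γ.2) with hfdef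
  have hfval : ∀ γ : DQ, ((f γ : DP) : absoluteGaloisGroup K₀) = absGaloisRestrict K₀ M γ :=
    fun _ ↦ rfl
  -- the representations of the decomposition groups on `V = V_ℓ(W)`
  set ID : Subgroup DP := 𝔓.inertia DP with hID
  haveI : ID.Normal := inferInstanceAs (𝔓.inertia DP).Normal
  set χD : DP →* ℚ_[ℓ]ˣ := χ.comp DP.subtype with hχD
  set ρD : Representation ℚ_[ℓ] DP (W.rationalTateModule ℓ) := ρ.toRepresentation.comp DP.subtype
    with hρD
  have hmemID : ∀ x : DP, x ∈ ID ↔ (x : absoluteGaloisGroup K₀) ∈ 𝔓.inertia (absoluteGaloisGroup K₀) :=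
    fun x ↦ Iff.rfl
  have hmemIQ : ∀ y : DQ, y ∈ 𝔔.inertia DQ ↔ (y : absoluteGaloisGroup M) ∈ 𝔔.inertia (absoluteGaloisGroup M) :=
    fun y ↦ Iff.rfl
  /- ### Euler factors as characteristic polynomials (the tree's theorem, for all pairs) -/
  have hinjmap : Function.Injective (Polynomial.map (Int.castRingHom ℚ_[ℓ])) :=
    Polynomial.map_injective _ (RingHom.injective_int _)
  -- `L_v(W)` at any Frobenius `σ ∈ D_𝔓`
  have hP : ∀ (σ : DP), IsArithFrobAt (𝓞 K₀) (σ : absoluteGaloisGroup K₀) 𝔓 →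
      (ρD.toCoinvariants ID σ).charpoly.reverse =
        (W.localPolynomialAt v).map (Int.castRingHom ℚ_[ℓ]) := fun σ hσ ↦
    W.reverse_charpoly_toInertiaCoinvariants_eq_localPolynomialAt ℓ hcW hℓv h𝔓 σ hσ
  -- `L_v(W^{(D)})` at any Frobenius, transported to the twist of `ρD`
  have hPd : ∀ (σ : DP), IsArithFrobAt (𝓞 K₀) (σ : absoluteGaloisGroup K₀) 𝔓 →
      ((Literature.RepresentationTheory.Semisimple.Representation.twist ρD χD).toCoinvariants ID σ).charpoly.reverse =
        ((W.quadraticTwist D).localPolynomialAt v).map (Int.castRingHom ℚ_[ℓ]) := by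
    intro σ hσ
    rw [← (W.quadraticTwist D).reverse_charpoly_toInertiaCoinvariants_eq_localPolynomialAt ℓ hcd
      hℓv h𝔓 σ hσ]
    congr 1
    symm
    refine charpoly_toCoinvariants_eq_of_equiv (Literature.RepresentationTheory.Semisimple.Representation.twist ρD χD)
      (ρd.toRepresentation.comp DP.subtype) (MonoidHom.id DP) Ed (fun g x ↦ ?_) ID ID
      (by rw [Subgroup.map_id]) σ
    change Ed ((W.quadraticTwist D).rationalGaloisRepTate ℓ (g : absoluteGaloisGroup K₀) x) =
      (χ (g : absoluteGaloisGroup K₀) : ℚ_[ℓ]) •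
        W.rationalGaloisRepTate ℓ (g : absoluteGaloisGroup K₀) (Ed x)
    exact hEd _ x
  -- `L_w(W_M)` at `Φ`, transported to `ρD` on the coinvariants for `I_𝔓 ∩ ker χ`
  have hS : ID ⊓ χD.ker = (𝔔.inertia DQ).map f := by
    ext x
    rw [Subgroup.mem_inf, MonoidHom.mem_ker, Subgroup.mem_map]
    constructor
    · rintro ⟨hxI, hxχ⟩
      change χ (x : absoluteGaloisGroup K₀) = 1 at hxχ
      obtain ⟨γ₀, hγ₀⟩ := hχH _ hxχ
      have hγ₀I : γ₀ ∈ 𝔔.inertia (absoluteGaloisGroup M) := by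
        rw [← comap_inertia_comap_absIntegersMap K₀ M 𝔔, Subgroup.mem_comap, hγ₀]
        exact hxI
      refine ⟨⟨γ₀, Ideal.inertia_le_decompositionSubgroup _ _ hγ₀I⟩, hγ₀I, Subtype.ext ?_⟩
      rw [hfval]
      exact hγ₀
    · rintro ⟨γ, hγ, rfl⟩
      refine ⟨?_, hHχ _⟩
      rw [hmemID, hfval]
      exact absGaloisRestrict_mem_inertia_comap K₀ M ((hmemIQ γ).mp hγ)
  have hQ : (ρD.toCoinvariants (ID ⊓ χD.ker) (f ⟨Φ, hΦD⟩)).charpoly.reverse =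
      ((W.baseChange M).localPolynomialAt w).map (Int.castRingHom ℚ_[ℓ]) := by
    rw [← (W.baseChange M).reverse_charpoly_toInertiaCoinvariants_eq_localPolynomialAt ℓ hcK hℓw
      h𝔔 ⟨Φ, hΦD⟩ hΦ]
    congr 1
    symm
    refine charpoly_toCoinvariants_eq_of_equiv ρD (ρK.toRepresentation.comp DQ.subtype) f EK.symm
      (fun g x ↦ ?_) (ID ⊓ χD.ker) (𝔔.inertia DQ) hS ⟨Φ, hΦD⟩
    apply EK.injective
    rw [LinearEquiv.apply_symm_apply]
    change (W.baseChange M).rationalGaloisRepTate ℓ (g : absoluteGaloisGroup M) x =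
      EK (W.rationalGaloisRepTate ℓ (absGaloisRestrict K₀ M g) (EK.symm x))
    rw [hEK, LinearEquiv.apply_symm_apply]
  /- ### The three cases -/
  have hI_of_e : w.asIdeal.ramificationIdx (𝓞 K₀) = 1 →
      𝔓.inertia (absoluteGaloisGroup K₀) ≤ H := by
    intro he
    have he' : v.asIdeal.ramificationIdxIn (𝓞 M) = 1 := by
      haveI : w.asIdeal.IsPrime := w.isPrime
      haveI : v.asIdeal.IsMaximal := v.isMaximal
      haveI : w.asIdeal.LiesOver v.asIdeal := ⟨hw.symm⟩
      haveI : IsGaloisGroup (M ≃ₐ[K₀] M) (𝓞 K₀) (𝓞 M) := IsGaloisGroup.of_isFractionRing _ _ _ K₀ M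
      rw [Ideal.ramificationIdxIn_eq_ramificationIdx v.asIdeal w.asIdeal (M ≃ₐ[K₀] M), he]
    exact inertia_le_range_absGaloisRestrict K₀ M he' h𝔓
  have hIDχ_of_e : w.asIdeal.ramificationIdx (𝓞 K₀) = 1 → ∀ j ∈ ID, χD j = 1 := by
    intro he j hj
    obtain ⟨γ, hγ⟩ := hI_of_e he ((hmemID j).mp hj)
    change χ (j : absoluteGaloisGroup K₀) = 1
    rw [← hγ]
    exact hHχ γ
  refine ⟨fun he hf ↦ ?_, fun he hf ↦ ?_, fun huniq hf ↦ ?_⟩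
  · /- **split**: `res Φ` is a Frobenius at `𝔓`, in `H`, and `I_𝔓 ≤ H = ker χ` -/
    have hIχ := hIDχ_of_e he
    have hφ : IsArithFrobAt (𝓞 K₀) (absGaloisRestrict K₀ M Φ) 𝔓 :=
      isArithFrobAt_absGaloisRestrict_of_inertiaDeg_eq_one hw h𝔔 hΦ hf
    have hinf : ID ⊓ χD.ker = ID := inf_eq_left.mpr fun j hj ↦ hIχ j hj
    have h1 : (W.baseChange M).localPolynomialAt w = W.localPolynomialAt v := by
      apply hinjmap
      rw [← hQ, charpoly_toCoinvariants_congr ρD hinf, hP (f ⟨Φ, hΦD⟩) hφ]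
    refine ⟨h1, ?_⟩
    apply hinjmap
    rw [← hPd (f ⟨Φ, hΦD⟩) hφ, charpoly_toCoinvariants_twist ρD χD ID hIχ]
    have hχΦ : (χD (f ⟨Φ, hΦD⟩) : ℚ_[ℓ]) = 1 := by
      change (χ (absGaloisRestrict K₀ M Φ) : ℚ_[ℓ]) = 1
      rw [hHχ, Units.val_one]
    rw [hχΦ, one_smul, hP (f ⟨Φ, hΦD⟩) hφ]
  · /- **inert**: `res Φ ≡ φ² (mod I_𝔓)`, `χ(φ) = -1`, and `det(1 - F²T²) = det(1 - FT)det(1 + FT)` -/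
    have hIχ := hIDχ_of_e he
    have hinf : ID ⊓ χD.ker = ID := inf_eq_left.mpr fun j hj ↦ hIχ j hj
    obtain ⟨φ, hφ⟩ := HeightOneSpectrum.exists_isArithFrobAt_of_mem_primesAbove_holds h𝔓
    have hφD : φ ∈ DP := hφ.mem_stabilizer
    have hrel : absGaloisRestrict K₀ M Φ * (φ ^ 2)⁻¹ ∈ 𝔓.inertia (absoluteGaloisGroup K₀) := by
      have h := absGaloisRestrict_mul_pow_inv_mem_inertia hw h𝔔 hΦ hφ
      rwa [hf] at h
    have hrel' : f ⟨Φ, hΦD⟩ * ((⟨φ, hφD⟩ : DP) ^ 2)⁻¹ ∈ ID := by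
      rw [hmemID]
      exact hrel
    -- `φ ∉ H` (a Frobenius in `H` would force `f = 1`), so `χ φ = -1`
    have hχφ : χ φ = -1 := by
      refine hχne φ fun h1 ↦ ?_
      obtain ⟨τ, hτ⟩ := hχH φ h1
      have hτ' : absGaloisRestrict K₀ M τ = φ := hτ
      have hf1 := inertiaDeg_eq_one_of_isArithFrobAt_absGaloisRestrict (F := K₀) hw h𝔔 (τ := τ)
        (by rw [hτ']; exact hφ)
      rw [hf] at hf1
      exact absurd hf1 (by norm_num)
    set F : Module.End ℚ_[ℓ] (Representation.Coinvariants (ρD.comp ID.subtype)) :=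
      ρD.toCoinvariants ID ⟨φ, hφD⟩ with hFdef
    have hQ' : ((W.baseChange M).localPolynomialAt w).map (Int.castRingHom ℚ_[ℓ]) =
        (F * F).charpoly.reverse := by
      rw [← hQ, charpoly_toCoinvariants_congr ρD hinf, toCoinvariants_eq_of_mul_inv_mem ρD ID hrel',
        map_pow, sq]
    have hPφ : F.charpoly.reverse = (W.localPolynomialAt v).map (Int.castRingHom ℚ_[ℓ]) :=
      hP ⟨φ, hφD⟩ hφ
    have hPdφ : (-F).charpoly.reverse =
        ((W.quadraticTwist D).localPolynomialAt v).map (Int.castRingHom ℚ_[ℓ]) := by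
      rw [← hPd ⟨φ, hφD⟩ hφ, charpoly_toCoinvariants_twist ρD χD ID hIχ]
      have hval : (χD ⟨φ, hφD⟩ : ℚ_[ℓ]) = -1 := by
        change (χ φ : ℚ_[ℓ]) = -1
        rw [hχφ, Units.val_neg, Units.val_one]
      rw [hval, neg_smul, one_smul]
    refine ⟨?_, ?_⟩
    · apply hinjmap
      rw [Polynomial.map_expand, Polynomial.map_mul, hQ', expand_two_reverse_charpoly_mul_self F, hPφ,
        hPdφ]
    · apply hinjmap
      rw [← hPdφ, reverse_charpoly_neg F, hPφ, Polynomial.map_comp]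
      simp
  · /- **ramified**: `τ ∈ I_𝔓 ∖ H` has `χ(τ) = -1`; the coinvariants for `I_𝔓 ∩ Γ_M` split -/
    have hHi : H.index = 2 := by rw [hH, index_range_absGaloisRestrict_eq_finrank, h2]
    have hHne : H ≠ ⊤ := fun htop ↦ by
      rw [htop, Subgroup.index_top] at hHi
      exact absurd hHi (by norm_num)
    obtain ⟨τ, hτI, hτH⟩ := exists_mem_inertia_not_mem_range hw huniq h𝔔 hf hHne
    have hτD : τ ∈ DP := Ideal.inertia_le_decompositionSubgroup _ _ hτI
    have hχτ : χD ⟨τ, hτD⟩ = -1 := hχne τ fun h1 ↦ hτH (hχH τ h1)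
    have hτID : (⟨τ, hτD⟩ : DP) ∈ ID := (hmemID _).mpr hτI
    have hφ : IsArithFrobAt (𝓞 K₀) (absGaloisRestrict K₀ M Φ) 𝔓 :=
      isArithFrobAt_absGaloisRestrict_of_inertiaDeg_eq_one hw h𝔔 hΦ hf
    have hχΦ : χD (f ⟨Φ, hΦD⟩) = 1 := hHχ Φ
    have hχI : ∀ i ∈ ID, χD i = 1 ∨ χD i = -1 := fun i _ ↦ hχpm _
    have h2ℓ : (2 : ℚ_[ℓ]) ≠ 0 := two_ne_zero
    have key := charpoly_toCoinvariants_inf_ker_eq_mul h2ℓ ρD ID χD hχI hτID hχτ hχΦ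
    apply hinjmap
    rw [Polynomial.map_mul, ← hQ, key, Polynomial.reverse_mul_of_domain, hP (f ⟨Φ, hΦD⟩) hφ,
      hPd (f ⟨Φ, hΦD⟩) hφ]

/-! ## The places of a quadratic extension above a place of the base -/

omit [W.IsElliptic] in
/-- **Decomposition of a place in a quadratic extension, place by place** (Neukirch I (8.2);
Marcus Ch. 3 Thm. 25, relative form).  Let `M/K` be an extension of number fields with
`[M : K] = 2` and `v` a finite place of `K`.  Then exactly one of: (split) there are two places
`w₁ ≠ w₂` of `M` above `v`, each with `e = f = 1`; (inert) there is a single place above `v`,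
with `e = 1`, `f = 2`; (ramified) there is a single place above `v`, with `e = 2`, `f = 1`
(Mathlib's fundamental identity `#{w ∣ v} · e · f = [M : K] = 2` for the Galois extension `M/K`,
`Ideal.ncard_primesOver_mul_ramificationIdxIn_mul_inertiaDegIn`). [folklore] -/
theorem _root_.Literature.NumberTheory.EllipticCurves.placesOver_trichotomy_relQuadratic
    (h2 : Module.finrank K₀ M = 2) (v : HeightOneSpectrum (𝓞 K₀)) :
    (∃ w₁ w₂ : HeightOneSpectrum (𝓞 M), w₁ ≠ w₂ ∧
        {w : HeightOneSpectrum (𝓞 M) | w.under (𝓞 K₀) = v} = {w₁, w₂} ∧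
        ∀ w : HeightOneSpectrum (𝓞 M), w.under (𝓞 K₀) = v →
          w.asIdeal.ramificationIdx (𝓞 K₀) = 1 ∧ w.asIdeal.inertiaDeg (𝓞 K₀) = 1) ∨
    (∃ w : HeightOneSpectrum (𝓞 M), {w' : HeightOneSpectrum (𝓞 M) | w'.under (𝓞 K₀) = v} = {w} ∧
        w.asIdeal.ramificationIdx (𝓞 K₀) = 1 ∧ w.asIdeal.inertiaDeg (𝓞 K₀) = 2) ∨
    (∃ w : HeightOneSpectrum (𝓞 M), {w' : HeightOneSpectrum (𝓞 M) | w'.under (𝓞 K₀) = v} = {w} ∧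
        w.asIdeal.ramificationIdx (𝓞 K₀) = 2 ∧ w.asIdeal.inertiaDeg (𝓞 K₀) = 1) := by
  haveI : Algebra.IsQuadraticExtension K₀ M := ⟨h2⟩
  haveI : FiniteDimensional K₀ M := Module.finite_of_finrank_pos (by rw [h2]; exact two_pos)
  haveI : v.asIdeal.IsMaximal := v.isMaximal
  set G := M ≃ₐ[K₀] M with hG_def
  haveI : IsGaloisGroup G (𝓞 K₀) (𝓞 M) := IsGaloisGroup.of_isFractionRing _ _ _ K₀ M
  have hG : Nat.card G = 2 := by rw [hG_def, IsGalois.card_aut_eq_finrank, h2]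
  -- the fundamental identity `n · (e · f) = 2`
  set n := (v.asIdeal.primesOver (𝓞 M)).ncard with hn_def
  set e := v.asIdeal.ramificationIdxIn (𝓞 M) with he_def
  set f := v.asIdeal.inertiaDegIn (𝓞 M) with hf_def
  have hid : n * (e * f) = 2 := by
    rw [hn_def, he_def, hf_def, Ideal.ncard_primesOver_mul_ramificationIdxIn_mul_inertiaDegIn
      v.asIdeal (𝓞 M) G, hG]
  have hn0 : n ≠ 0 := IsDedekindDomain.primesOver_ncard_ne_zero v.asIdeal (𝓞 M)
  have he0 : e ≠ 0 := Ideal.ramificationIdxIn_ne_zero G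
  have hf0 : f ≠ 0 := Ideal.inertiaDegIn_ne_zero G
  -- `e(w|v) = e`, `f(w|v) = f` for every place `w` above `v`
  have hef : ∀ w : HeightOneSpectrum (𝓞 M), w.under (𝓞 K₀) = v →
      w.asIdeal.ramificationIdx (𝓞 K₀) = e ∧ w.asIdeal.inertiaDeg (𝓞 K₀) = f := by
    intro w hw
    haveI : w.asIdeal.LiesOver v.asIdeal := ⟨by rw [← hw]; rfl⟩
    exact ⟨(Ideal.ramificationIdxIn_eq_ramificationIdx v.asIdeal w.asIdeal G).symm,
      (Ideal.inertiaDegIn_eq_inertiaDeg v.asIdeal w.asIdeal G).symm⟩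
  -- the places above `v` are the primes over `v.asIdeal`
  have hcard : Nat.card {w : HeightOneSpectrum (𝓞 M) // w.under (𝓞 K₀) = v} = n := by
    rw [hn_def, ← Nat.card_coe_set_eq]
    refine Nat.card_congr
      { toFun := fun w ↦ ⟨w.1.asIdeal, w.1.isPrime, ⟨(congrArg HeightOneSpectrum.asIdeal w.2).symm⟩⟩
        invFun := fun P ↦ ⟨⟨P.1, P.2.1, Ideal.ne_bot_of_mem_primesOver v.ne_bot P.2⟩,
          HeightOneSpectrum.ext P.2.2.over.symm⟩
        left_inv := fun w ↦ by ext1; rfl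
        right_inv := fun P ↦ by rfl }
  -- arithmetic: `(n, e, f) ∈ {(2, 1, 1), (1, 1, 2), (1, 2, 1)}`
  have hn2 : n ≤ 2 := Nat.le_of_dvd two_pos ⟨e * f, hid.symm⟩
  have he2 : e ≤ 2 := Nat.le_of_dvd two_pos ⟨n * f, by rw [← hid]; ring⟩
  interval_cases n
  · exact absurd rfl hn0
  · -- one place above `v`
    rw [one_mul] at hid
    obtain ⟨w₀, hw₀⟩ := Nat.card_eq_one_iff_exists.mp hcard
    have hset : {w' : HeightOneSpectrum (𝓞 M) | w'.under (𝓞 K₀) = v} = {w₀.1} := by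
      ext w'
      simp only [Set.mem_setOf_eq, Set.mem_singleton_iff]
      exact ⟨fun h ↦ congrArg Subtype.val (hw₀ ⟨w', h⟩), fun h ↦ h ▸ w₀.2⟩
    obtain ⟨hew, hfw⟩ := hef w₀.1 w₀.2
    interval_cases e
    · exact absurd rfl he0
    · right; left
      exact ⟨w₀.1, hset, hew, by rw [hfw]; omega⟩
    · right; right
      exact ⟨w₀.1, hset, hew, by rw [hfw]; omega⟩
  · -- two places above `v`
    left
    obtain ⟨x, y, hxy, hxy'⟩ := Nat.card_eq_two_iff.mp hcard
    have hef1 : e = 1 ∧ f = 1 := by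
      have : e * f = 1 := by omega
      exact ⟨Nat.eq_one_of_mul_eq_one_right this, Nat.eq_one_of_mul_eq_one_left this⟩
    refine ⟨x.1, y.1, fun h ↦ hxy (Subtype.ext h), ?_, fun w hw ↦ ?_⟩
    · ext w'
      simp only [Set.mem_setOf_eq, Set.mem_insert_iff, Set.mem_singleton_iff]
      constructor
      · intro h
        have hmem : (⟨w', h⟩ : {w : HeightOneSpectrum (𝓞 M) // w.under (𝓞 K₀) = v}) ∈
            ({x, y} : Set _) := by rw [hxy']; exact Set.mem_univ _
        rcases hmem with h1 | h1
        · exact Or.inl (congrArg Subtype.val h1)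
        · exact Or.inr (congrArg Subtype.val h1)
      · rintro (rfl | rfl)
        · exact x.2
        · exact y.2
    · obtain ⟨hew, hfw⟩ := hef w hw
      exact ⟨hew.trans hef1.1, hfw.trans hef1.2⟩

/-! ## The Euler factors of `E_M` above `v` -/

/-- **`∏_{w ∣ v} L_w(E_M, N w^{-s})⁻¹ = L_v(E, N v^{-s})⁻¹ · L_v(E^{(D)}, N v^{-s})⁻¹`** for a
relative quadratic extension `M = K(θ)`, `θ² = D ∈ K`, `θ ∉ K`, and every finite place `v` of
`K`, as an identity of formal Dirichlet series (Mathlib's local Euler factors on the completions):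
the local identities of `localPolynomialAt_baseChange_relQuadratic` in the three cases of
`placesOver_trichotomy_relQuadratic`, assembled exactly as in the base-`ℚ`
`finprod_localEulerFactor_baseChange_quadratic` (`N w = (N v)^{f(w|v)}`,
`ofPowerSeries (q²) F = ofPowerSeries q (F(T²))`, `(L L')⁻¹ = L⁻¹ L'⁻¹`).
[cite: IrelandRosen1990, Ch. 20 §5, Prop. 20.5.4(b) (PDF p. 353)] -/
theorem finprod_localEulerFactor_baseChange_relQuadratic (h2 : Module.finrank K₀ M = 2)
    {D : K₀} (hD0 : D ≠ 0) {θ : M} (hθ : θ ^ 2 = algebraMap K₀ M D)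
    (hθF : θ ∉ Set.range (algebraMap K₀ M)) (v : HeightOneSpectrum (𝓞 K₀)) :
    ∏ᶠ w ∈ {w : HeightOneSpectrum (𝓞 M) | w.under (𝓞 K₀) = v},
        ((W.baseChange M).baseChange (w.adicCompletion M)).localEulerFactor
          (w.adicCompletionIntegers M) =
      (W.baseChange (v.adicCompletion K₀)).localEulerFactor (v.adicCompletionIntegers K₀) *
        ((W.quadraticTwist D).baseChange (v.adicCompletion K₀)).localEulerFactor
          (v.adicCompletionIntegers K₀) := by
  have hPc : PowerSeries.constantCoeff (W.localPolynomialAt v : PowerSeries ℤ) = 1 := by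
    rw [Polynomial.constantCoeff_coe, W.coeff_zero_localPolynomialAt v]
  have hPdc : PowerSeries.constantCoeff
      ((W.quadraticTwist D).localPolynomialAt v : PowerSeries ℤ) = 1 := by
    rw [Polynomial.constantCoeff_coe, (W.quadraticTwist D).coeff_zero_localPolynomialAt v]
  have hwv : ∀ {w : HeightOneSpectrum (𝓞 M)}, w.under (𝓞 K₀) = v →
      w.asIdeal.under (𝓞 K₀) = v.asIdeal := fun hw ↦ congrArg HeightOneSpectrum.asIdeal hw
  -- the right-hand side
  rw [W.localEulerFactor_baseChange_adicCompletion v,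
    (W.quadraticTwist D).localEulerFactor_baseChange_adicCompletion v]
  rcases placesOver_trichotomy_relQuadratic M h2 v with
    ⟨w₁, w₂, hne, hset, hef⟩ | ⟨w, hset, he, hf⟩ | ⟨w, hset, he, hf⟩
  · -- split: two places, `L_{wᵢ} = L_v(E) = L_v(E^{(D)})`
    have hw₁ : w₁.under (𝓞 K₀) = v := by
      have h : w₁ ∈ ({w₁, w₂} : Set (HeightOneSpectrum (𝓞 M))) := Set.mem_insert _ _
      rwa [← hset] at h
    have hw₂ : w₂.under (𝓞 K₀) = v := by
      have h : w₂ ∈ ({w₁, w₂} : Set (HeightOneSpectrum (𝓞 M))) :=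
        Set.mem_insert_of_mem _ (Set.mem_singleton _)
      rwa [← hset] at h
    have key : ∀ {w : HeightOneSpectrum (𝓞 M)}, w.under (𝓞 K₀) = v →
        ((W.baseChange M).baseChange (w.adicCompletion M)).localEulerFactor
            (w.adicCompletionIntegers M) =
          ofPowerSeries v.residueCard
            (PowerSeries.invOfUnit (W.localPolynomialAt v : PowerSeries ℤ) 1) := by
      intro w hw
      obtain ⟨hew, hfw⟩ := hef w hw
      obtain ⟨hL, -⟩ :=
        (W.localPolynomialAt_baseChange_relQuadratic M h2 hD0 hθ hθF (hwv hw)).1 hew hfw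
      rw [(W.baseChange M).localEulerFactor_baseChange_adicCompletion w, hL,
        residueCard_eq_residueCard_pow_inertiaDeg (hwv hw), hfw, pow_one]
    have hPd : (W.quadraticTwist D).localPolynomialAt v = W.localPolynomialAt v := by
      obtain ⟨hew, hfw⟩ := hef w₁ hw₁
      exact ((W.localPolynomialAt_baseChange_relQuadratic M h2 hD0 hθ hθF (hwv hw₁)).1 hew hfw).2
    rw [hset, finprod_mem_pair hne, key hw₁, key hw₂, hPd]
  · -- inert: one place, `N w = (N v)²`, `L_w(T²) = L_v(E)(T) L_v(E^{(D)})(T)`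
    have hw : w.under (𝓞 K₀) = v := by
      have h : w ∈ ({w} : Set (HeightOneSpectrum (𝓞 M))) := Set.mem_singleton _
      rwa [← hset] at h
    have hL := ((W.localPolynomialAt_baseChange_relQuadratic M h2 hD0 hθ hθF (hwv hw)).2.1 he hf).1
    rw [hset, finprod_mem_singleton, (W.baseChange M).localEulerFactor_baseChange_adicCompletion w,
      residueCard_eq_residueCard_pow_inertiaDeg (hwv hw), hf,
      ofPowerSeries_pow _ two_ne_zero,
      PowerSeries.subst_X_pow_invOfUnit_coe two_ne_zero _
        ((W.baseChange M).coeff_zero_localPolynomialAt w),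
      hL, Polynomial.coe_mul, PowerSeries.invOfUnit_mul_of_constantCoeff_eq_one hPc hPdc, map_mul]
  · -- ramified: one place, `N w = N v`, `L_w = L_v(E) L_v(E^{(D)})`
    have hw : w.under (𝓞 K₀) = v := by
      have h : w ∈ ({w} : Set (HeightOneSpectrum (𝓞 M))) := Set.mem_singleton _
      rwa [← hset] at h
    have huniq : ∀ w' : HeightOneSpectrum (𝓞 M), w'.asIdeal.under (𝓞 K₀) = v.asIdeal → w' = w := by
      intro w' hw'
      have h : w' ∈ ({w} : Set (HeightOneSpectrum (𝓞 M))) := by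
        rw [← hset]
        exact HeightOneSpectrum.ext hw'
      exact h
    have hL := (W.localPolynomialAt_baseChange_relQuadratic M h2 hD0 hθ hθF (hwv hw)).2.2 huniq hf
    rw [hset, finprod_mem_singleton, (W.baseChange M).localEulerFactor_baseChange_adicCompletion w,
      residueCard_eq_residueCard_pow_inertiaDeg (hwv hw), hf, pow_one, hL, Polynomial.coe_mul,
      PowerSeries.invOfUnit_mul_of_constantCoeff_eq_one hPc hPdc, map_mul]

end WeierstrassCurve

end
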